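import Summits.CriticalPhenomena.CardyFormulaZ2.Theorems.CardyComplexConeParafermionToSLESixFamiliesDiamondTurnCountLocal
import Summits.CriticalPhenomena.CardyFormulaZ2.Theorems.CardyComplexConeParafermionToSLESixFamiliesDiamondTurnCountEscapePath
import Summits.CriticalPhenomena.CardyFormulaZ2.Theorems.CardyComplexConeParafermionToSLESixFamiliesDiamondTurnCountSelect
import Summits.CriticalPhenomena.CardyFormulaZ2.Theorems.CardyComplexConeParafermionToSLESixFamiliesDiamondTurnCountGadget
import Summits.CriticalPhenomena.CardyFormulaZ2.Theorems.CardyComplexConeParafermionToSLESixFamiliesDiamondTraceBulkArcs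
import Summits.CriticalPhenomena.CardyFormulaZ2.Theorems.CardyComplexConeParafermionToSLESixFamiliesDiamondDefsR3
import HarnessLib

/-!
# Stub S1t `stub_freeSideTurnCount`: the winding of the exploration at the touch darts of a straight free side is
# configuration-independent (line `potential-darboux-picard-diamond` of crux `ParafermionToSLESixFamilies`)

Crux `ParafermionToSLESixFamilies` (stmt-CriticalPhenomena-11389), line `potential-darboux-picard-diamond`, registered stub
`stub_freeSideTurnCount : FreeSideTurnCount` (`…DiamondDefsR3.lean`): along an admissible family of a marked diamond, for
every oriented free boundary segment `[p, q]` and trim `η > 0`, eventually in the mesh `δ`, there are a corner index `j`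
and an integer `T` such that the turn count of the exploration at every passage, before the exit, through a corner
`(u, j)` of a touch site `u` of the trimmed segment (within `3δ` of it, `η`-away from `p, q`, off the free arc, with
`u + u_{j+1}` on it) equals `T` — Duminil-Copin–Hongler–Nolin's "the winding `W(e_a, e)` at a free-arc edge is
deterministic" (CPAM 64 (2011), Lemma 12) for the tree's medial exploration on a diamond.

PROOF. The segment lies on one side `k` of the frame rectangle (`isBdrySegment_sideData`); take `j = k + 2`. For small
`δ` (all lattice points of the diamond in `Ω_δ`, the arcs near the bulk of the segment known, the start edge `e_a` within
`ε = min(η, γ)/16` of a mark, `δ ≤ η/100`, `δ ≤ γ/10`), fix the admissible datum `Λ δ`: the outer corner `p⋆` of the face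
across `e_a` is outside (`exists_outerCorner_of_isStartCorner`) and carries one of the two gadgets (`gadget_data`), the
route `Q` from the far corner of the box `[-K, K]²`, `K = 3 ⌈(‖c‖ + α + β)/δ⌉ + 10`, back to `p⋆` is chosen from the
position of `p⋆` and the mark (`route_select`), and `T := -4 - ((-1 + walkTurns (k + 1) Q) + g)`.

* `turnCount_touchSite` — the heart: for every touch site `u` of the trimmed segment the vertex path
  `prefixPath k u K ++ Q` is an escape of `(u, k + 2)` through forbidden vertices (`touchSite_local`, the route classes,
  the gadget) with no repeated vertex and the far corner as extreme corner of the side functional, whose signed turning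
  does not depend on `u` (`splice_escapeData`); the landed toolkit `MedialExplorationVertexEscape` / `…SideWinding` /
  `…VertexEscapeB` gives the turn count `-4 - ((-1 + walkTurns (k + 1) Q) + g)`.
* `stub_freeSideTurnCount` — the assembly along the family.
-/

noncomputable section

namespace Summit.CriticalPhenomena.CardyFormulaZ2.Cruxes.ParafermionToSLESixFamilies.PotentialDarbouxPicardDiamond

open scoped Topology
open Filter Set Metric Complex
open Literature.Probability Literature.Probability.LatticeModels Literature.Probability.Percolation
open Literature.Probability.LatticeModels.DiscreteDobrushin
open Literature.Probability.RandomPlanarGeometry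
open Summit.CriticalPhenomena.CardyFormulaZ2.Cruxes.ParafermionToSLESixFamilies.IicTraceFluxPairing (IsFamily)

/-! ## The escape of one touch site -/

/-- **The winding at the touch dart of one touch site.** See the module docstring. -/
theorem turnCount_touchSite : ∀ (D : DobrushinDomain) (c : ℂ) (α β : ℝ), D.carrier = {z | |((z - c) * exp (-(Real.pi / 4 : ℝ) * I)).re| < α ∧ |((z - c) * exp (-(Real.pi / 4 : ℝ) * I)).im| < β} → ∀ (k : Fin 4) (sp sq : ℝ) (p q : ℂ), 0 ≤ sp → sq ≤ dLen α β k → dRot c p = dParam α β k sp → dRot c q = dParam α β k sq → sp ≤ sq → ∀ (E : DiscreteDobrushin) (hE : E.IsZdAdmissible) (δ η : ℝ), 0 < δ → 100 * δ ≤ η → 10 * δ ≤ gam α β k → E.Ω = D.carrier → E.δ = δ → (∀ x : Site 2, meshPoint δ x ∈ D.carrier → x ∈ meshDomain D.carrier δ) → (∀ x : Site 2, infDist (meshPoint δ x) (segment ℝ p q) ≤ 6 * δ → η / 2 ≤ dist (meshPoint δ x) p → η / 2 ≤ dist (meshPoint δ x) q → x ∉ E.zdArcA ∧ (x ∈ E.zdBoundary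 → x ∈ E.zdArcB)) → ∀ (ι : Site 2 → ℤ), (∀ v : Site 2, meshPoint δ v ∉ D.carrier → ι v = 0) → (∀ v : Site 2, meshPoint δ v ∈ D.carrier → ι v = 1) → ∀ (K₀ : ℕ), (∀ v : Site 2, meshPoint δ v ∈ D.carrier → |xiC k v| ≤ K₀ ∧ |upC k v| ≤ K₀) → (∀ v : Site 2, (xiC k v = 3 * K₀ + 10 ∨ xiC k v = -(3 * K₀ + 10) ∨ upC k v = 3 * K₀ + 10 ∨ upC k v = -(3 * K₀ + 10)) → meshPoint δ v ∉ D.carrier) → ∀ (ps : Site 2), meshPoint δ ps ∉ D.carrier → ∀ (gds : List (Fin 4)) (g : ℤ), gds ≠ [] → pathEnd ps gds = (startCorner hE).1 → (∀ v ∈ pathVerts ps gds, v = ps ∨ v = (startCorner hE).1 + cornerUnit (startCorner hE).2) → (∀ (u : Site 2) (j : Fin 4) (ds : List (Fin 4)) (d : Site 2 × Fin 4) (S : ℤ), ds.head? = some (j + 1) → 2 ≤ ds.length → pathEnd u ds = (startCorner hE).1 → lastDir ds = lastDir gds → (∀ v ∈ (pathVerts u ds).tail, (∀ i : Fin 4,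 ¬ E.IsInnerFace (faceAt v i)) ∨ v ∈ E.zdArcB) → (pathVerts u ds ++ [(startCorner hE).1]).Nodup → d ∈ cornerWalk u j ds → d.2 = j + 3 → (∀ p' : Site 2 × Fin 4, E.IsInnerFace (cFace p') → sideVal j (cpos p') ≤ S) → (∀ d' ∈ cornerWalk u j ds, sideVal j (cpos d') ≤ S) → sideVal j (cpos ((startCorner hE).1, (startCorner hE).2 + 3)) ≤ S → sideVal j (cpos d) = S → ∀ (ω : BondConfig (Site 2)) (t : ℕ), t < exitTime hE ω → cornerOrbit (E.bcBondConfig ω) (startCorner hE) t = (u, j) → turnCount (E.bcBondConfig ω) (startCorner hE) t = -4 - (walkTurns j ds + g)) → ∀ (Q : List (Fin 4)) (C : Site 2 → Prop), (∀ v : Site 2, C v → ι v = 0) → (∀ vs : Site 2, xiC k vs = 3 * K₀ + 10 → upC k vs = -(3 * K₀ + 10) → ∃ Qt : List (Fin 4), Q = (k + 2) :: Qt ∧ pathEnd vs Q = pathEnd ps gds ∧ lastDir Q = lastDir gds ∧ (∀ v ∈ pathVerts vs Q, C v ∨ v ∈ pathVerts ps gds) ∧ (pathVerts vs Q).Nodup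 ∧ pathEnd ps gds ∉ pathVerts vs Q ∧ (∀ b ∈ pathVerts vs Q, b = vs ∨ xiC k b - upC k b ≤ 2 * (3 * K₀ + 10) - 1)) → (∀ u : Site 2, gam α β k - 3 * δ ≤ Fk k (dRot c (meshPoint δ u)) → Fk k (dRot c (meshPoint δ u)) < gam α β k → sp + η - 6 * δ - gam' α β k ≤ Gk k (dRot c (meshPoint δ u)) → Gk k (dRot c (meshPoint δ u)) ≤ sq - η + 6 * δ - gam' α β k → meshPoint δ u ∈ D.carrier → (∀ v : Site 2, C v → SafeVertex k u (3 * K₀ + 10) ι v) ∧ (∀ v ∈ pathVerts ps gds, SafeVertex k u (3 * K₀ + 10) ι v)) → ∀ (u : Site 2), infDist (meshPoint δ u) (segment ℝ p q) ≤ 3 * δ → η ≤ dist (meshPoint δ u) p → η ≤ dist (meshPoint δ u) q → u + cornerUnit (k + 2 + 1) ∈ E.zdArcB → ∀ (ω : BondConfig (Site 2)) (t : ℕ), t < exitTime hE ω → cornerOrbit (E.bcBondConfig ω) (startCorner hE) t = (u, k + 2) → turnCount (E.bcBondConfig ω) (startCorner hE) t = -4 - ((-1 + walkTurns (k + 1)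 Q) + g) := by
  intro D c α β hcar k sp sq p q hsp0 hsqL hpk hqk hspq E hE δ η hδ hδη hδγ hEΩ hEδ hgood harcs ι hι0 hι1 K₀ hK₀in hK₀out ps hpsout
    gds g hgds hgend hgV hHT Q C hC0 hQdata hQsafe u hd hp hq hb ω t ht horb
  have hsc := isStartCorner_startCorner hE
  have hx0in : meshPoint δ (startCorner hE).1 ∈ D.carrier := by
    have := mem_of_mem_zdBoundary (E.zdArcA_subset_zdBoundary hsc.mem_zdArcA); rwa [hEΩ, hEδ] at this
  have hb3 : u + cornerUnit (k + 3) ∈ E.zdArcB := by rwa [fin4_add_two_add_one] at hb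
  -- outside sites have no inner face
  have hout0 : ∀ v : Site 2, ι v = 0 → ∀ i : Fin 4, ¬ E.IsInnerFace (faceAt v i) := by
    intro v hv
    have hv' : meshPoint E.δ v ∉ E.Ω := by
      rw [hEΩ, hEδ]; intro h; have := hι1 v h; omega
    exact forall_not_isInnerFace_of_not_mem hv'
  -- `u` is a site of the diamond: the touch dart has an inner face
  have huin : meshPoint δ u ∈ D.carrier := by
    have h1 := isInnerFace_of_lt_exitTime hE ω ht
    rw [horb] at h1
    have := corner_mem_of_isInnerFace h1 (isCorner_cFace (u, k + 2))
    rwa [hEΩ, hEδ] at this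
  obtain ⟨⟨hFu1, hFu2, hGu1, hGu2⟩, hfar, hw, hb1in, hnoA⟩ :=
    touchSite_local D c α β hcar k sp sq p q hsp0 hsqL hpk hqk hspq E δ η hδ hδη hδγ hEΩ hEδ hgood harcs u hd hp hq huin hb3
  obtain ⟨hu1, hu2⟩ := hK₀in u huin
  rw [abs_le] at hu1 hu2
  have hK1 : xiC k u + 2 ≤ 3 * K₀ + 10 := by omega
  have hK2 : 1 ≤ upC k u - 1 + (3 * K₀ + 10) := by omega
  have hvs1 := xiC_pathEnd_prefixPath k u (3 * K₀ + 10) hK1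
  have hvs2 := upC_pathEnd_prefixPath k u (3 * K₀ + 10) (by omega)
  obtain ⟨Qt, hQ, hend, hlast, hmem, hnd, hnew, hreg⟩ := hQdata (pathEnd u (prefixPath k u (3 * K₀ + 10))) hvs1 hvs2
  obtain ⟨hsafeC, hsafeG⟩ := hQsafe u hFu1 hFu2 hGu1 hGu2 huin
  subst hQ
  -- the inputs of the splicing lemma
  have hιu : ι u = 1 := hι1 u huin
  have hιb : ι (u + cornerUnit (k + 3)) = 1 := hι1 _ hb1in
  have hιE : ∀ v : Site 2, upC k v = upC k u - 1 → xiC k u + 2 ≤ xiC k v → ι v = 0 :=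
    fun v h1 h2 => hι0 v (hfar v (by omega))
  have hιS : ∀ v : Site 2, xiC k v = 3 * K₀ + 10 → ι v = 0 := fun v h => hι0 v (hK₀out v (Or.inl h))
  have hsafe : ∀ b ∈ pathVerts (pathEnd u (prefixPath k u (3 * K₀ + 10))) ((k + 2) :: Qt), SafeVertex k u (3 * K₀ + 10) ι b :=
    fun b hb' => (hmem b hb').elim (hsafeC b) (hsafeG b)
  have hxend : pathEnd (pathEnd u (prefixPath k u (3 * K₀ + 10))) ((k + 2) :: Qt) = (startCorner hE).1 := hend.trans hgend
  have hx' : pathEnd (pathEnd u (prefixPath k u (3 * K₀ + 10))) ((k + 2) :: Qt) ∉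
      pathVerts (pathEnd u (prefixPath k u (3 * K₀ + 10))) ((k + 2) :: Qt) := by rw [hend]; exact hnew
  have hιx : ι (pathEnd (pathEnd u (prefixPath k u (3 * K₀ + 10))) ((k + 2) :: Qt)) = 1 := by rw [hxend]; exact hι1 _ hx0in
  have hxbox : ¬ (xiC k u ≤ xiC k (pathEnd (pathEnd u (prefixPath k u (3 * K₀ + 10))) ((k + 2) :: Qt)) ∧
      xiC k (pathEnd (pathEnd u (prefixPath k u (3 * K₀ + 10))) ((k + 2) :: Qt)) ≤ xiC k u + 1 ∧
      upC k u - 1 ≤ upC k (pathEnd (pathEnd u (prefixPath k u (3 * K₀ + 10))) ((k + 2) :: Qt)) ∧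
      upC k (pathEnd (pathEnd u (prefixPath k u (3 * K₀ + 10))) ((k + 2) :: Qt)) ≤ upC k u) := by
    rw [hxend]
    intro hbox
    exact hnoA (startCorner hE).1 (by rw [abs_le]; omega) (by rw [abs_le]; omega) hsc.mem_zdArcA
  obtain ⟨hhead, hlen, hpe, hld, hnodup, htail, hdmem, hdval, hdom, hwt⟩ :=
    splice_escapeData k u (3 * K₀ + 10) ι Qt hK1 hK2 hιu hιb hιE hιS hsafe hnd hx' hιx hxbox hreg
  -- the inputs of the gadget's turn-count theorem
  have hforb : ∀ v ∈ (pathVerts u (prefixPath k u (3 * K₀ + 10) ++ (k + 2) :: Qt)).tail,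
      (∀ i : Fin 4, ¬ E.IsInnerFace (faceAt v i)) ∨ v ∈ E.zdArcB := by
    intro v hv
    rcases htail v hv with rfl | rfl | h0 | hQv
    · exact Or.inr hb3
    · exact hw
    · exact Or.inl (hout0 v h0)
    · rcases hmem v hQv with hC | hg
      · exact Or.inl (hout0 v (hC0 v hC))
      · rcases hgV v hg with rfl | rfl
        · exact Or.inl (hout0 v (hι0 v hpsout))
        · exact Or.inr hsc.mem_zdArcB
  have hbound : ∀ v : Site 2, meshPoint δ v ∈ D.carrier → ∀ m : Fin 4, sideVal (k + 2) (cpos (v, m)) ≤ 2 * (3 * K₀ + 10) - 1 + cK k := by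
    intro v hv m
    obtain ⟨h1, h2⟩ := hK₀in v hv
    rw [abs_le] at h1 h2
    have := sideVal_cpos_le k v m
    omega
  have hI : ∀ p' : Site 2 × Fin 4, E.IsInnerFace (cFace p') → sideVal (k + 2) (cpos p') ≤ 2 * (3 * K₀ + 10) - 1 + cK k := by
    rintro ⟨v, m⟩ hp'
    have hin : meshPoint δ v ∈ D.carrier := by
      have := corner_mem_of_isInnerFace hp' (isCorner_cFace (v, m)); rwa [hEΩ, hEδ] at this
    exact hbound v hin m
  rw [hxend] at hnodup
  have key := hHT u (k + 2) (prefixPath k u (3 * K₀ + 10) ++ (k + 2) :: Qt) (pathEnd u (prefixPath k u (3 * K₀ + 10)), k + 1)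
    (2 * (3 * K₀ + 10) - 1 + cK k) hhead hlen (hpe.trans hxend) (hld.trans hlast) hforb hnodup hdmem (fin4_add_two_add_three k).symm
    hI hdom (hbound _ hx0in _) hdval ω t ht horb
  rw [key, hwt]

/-! ## The assembly -/

/-- **S1t: the winding of the exploration at the touch darts of a straight free side is configuration-independent.** -/
theorem stub_freeSideTurnCount : FreeSideTurnCount := by
  classical
  intro D hD Λ hΛ p q hpq hsub η hη
  obtain ⟨c, α, β, hα, hβ, hcar⟩ := hD
  have hcar' : D.carrier = {z | |(dRot c z).re| < α ∧ |(dRot c z).im| < β} := hcar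
  obtain ⟨k, sp, sq, hsp0, hspq, hsqL, hpk, hqk⟩ := isBdrySegment_sideData D c α β hα hβ hcar p q hpq
  have hΩ := hΛ.1
  have hmesh := hΛ.2.1
  have hγ : 0 < gam α β k := gam_pos hα hβ k
  -- the two scales `ε` (position of the start edge) and `δ₀` (mesh)
  set ε : ℝ := min (η / 16) (gam α β k / 16) with hε
  have hε0 : 0 < ε := lt_min (by positivity) (by positivity)
  have E1 := eventually_mem_meshDomain_of_isMarkedDiamond D ⟨c, α, β, hα, hβ, hcar⟩
  have E2 := eventually_arcs_near_freeSegment D Λ hΛ p q hpq hsub (η / 2) (by positivity)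
  have E3 := eventually_startCorner_near_marks D Λ hΛ ε hε0
  have E4 : ∀ᶠ δ in 𝓝[>] (0:ℝ), 0 < δ ∧ δ < min (η / 100) (gam α β k / 10) := by
    filter_upwards [Ioo_mem_nhdsGT (lt_min (by positivity) (by positivity) : (0:ℝ) < min (η / 100) (gam α β k / 10))]
      with δ hδ using hδ
  filter_upwards [E1, E2, E3, E4] with δ hgood harcs hstart hδ
  obtain ⟨hδ0, hδ1⟩ := hδ
  have hδη : 100 * δ ≤ η := by have := lt_of_lt_of_le hδ1 (min_le_left _ _); linarith
  have hδγ : 10 * δ ≤ gam α β k := by have := lt_of_lt_of_le hδ1 (min_le_right _ _); linarith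
  have hεη : 16 * ε ≤ η := by have := min_le_left (η / 16) (gam α β k / 16); linarith
  have hεγ : 16 * ε ≤ gam α β k := by have := min_le_right (η / 16) (gam α β k / 16); linarith
  intro hadm
  have hEΩ : (Λ δ).Ω = D.carrier := hΩ δ
  have hEδ : (Λ δ).δ = δ := hmesh δ
  have hconv : Convex ℝ D.carrier := by rw [hcar]; exact convex_tiltedBox c _ α β
  have hconvE : Convex ℝ (Λ δ).Ω := by rw [hEΩ]; exact hconv
  have hgoodE : ∀ x : Site 2, meshPoint (Λ δ).δ x ∈ (Λ δ).Ω → x ∈ meshDomain (Λ δ).Ω (Λ δ).δ := by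
    rw [hEΩ, hEδ]; exact hgood
  -- the start corner and the outer corner of the face across the start edge
  have hsc := isStartCorner_startCorner hadm
  obtain ⟨ps, hps, hpsout⟩ := exists_outerCorner_of_isStartCorner (Λ δ) hconvE hgoodE (startCorner hadm) hsc
  rw [hEΩ, hEδ] at hpsout
  have hx0in : meshPoint δ (startCorner hadm).1 ∈ D.carrier := by
    have := mem_of_mem_zdBoundary ((Λ δ).zdArcA_subset_zdBoundary hsc.mem_zdArcA); rwa [hEΩ, hEδ] at this
  -- the mark near the start edge
  obtain ⟨a, hafr, haseg, hpa⟩ : ∃ a : ℂ, a ∈ frontier D.carrier ∧ a ∉ openSegment ℝ p q ∧ dist (meshPoint δ ps) a ≤ ε + 3 * δ := by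
    have hmid := dist_medialPoint_cSrc_le hδ0.le (startCorner hadm)
    have hps' : dist (meshPoint δ ps) (meshPoint δ (startCorner hadm).1) ≤ 2 * δ := by
      rw [dist_eq_norm]
      rcases hps with rfl | rfl
      · rw [norm_meshPoint_add_cornerUnit_sub hδ0.le]; linarith
      · exact norm_meshPoint_add_add_sub_le hδ0.le _ _ _
    obtain ⟨-, -, h0, h1, -⟩ := hpq
    rcases hstart hadm with h | h
    · refine ⟨D.pt 0, D.pt_mem_frontier 0, h0, ?_⟩
      have := dist_triangle4 (meshPoint δ ps) (meshPoint δ (startCorner hadm).1) (medialPoint δ (cSrc (startCorner hadm))) (D.pt 0)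
      rw [dist_comm (meshPoint δ (startCorner hadm).1)] at this
      linarith
    · refine ⟨D.pt 1, D.pt_mem_frontier 1, h1, ?_⟩
      have := dist_triangle4 (meshPoint δ ps) (meshPoint δ (startCorner hadm).1) (medialPoint δ (cSrc (startCorner hadm))) (D.pt 1)
      rw [dist_comm (meshPoint δ (startCorner hadm).1)] at this
      linarith
  -- the far size and the indicator of the diamond
  set K₀ : ℕ := ⌈(‖c‖ + α + β) / δ⌉₊ with hK₀
  have hK₀in : ∀ v : Site 2, meshPoint δ v ∈ D.carrier → |xiC k v| ≤ K₀ ∧ |upC k v| ≤ K₀ :=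
    fun v hv => (abs_xiC_upC_le_iff k v K₀).2 (abs_coord_le_of_mem_carrier hcar' hδ0 hv)
  have hK₀out : ∀ v : Site 2, (xiC k v = 3 * K₀ + 10 ∨ xiC k v = -(3 * K₀ + 10) ∨ upC k v = 3 * K₀ + 10 ∨
      upC k v = -(3 * K₀ + 10)) → meshPoint δ v ∉ D.carrier := by
    intro v hv h
    obtain ⟨h1, h2⟩ := hK₀in v h
    rw [abs_le] at h1 h2
    omega
  set ι : Site 2 → ℤ := fun v => if meshPoint δ v ∈ D.carrier then 1 else 0 with hι
  have hι0 : ∀ v : Site 2, meshPoint δ v ∉ D.carrier → ι v = 0 := fun v h => by simp [hι, h]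
  have hι1 : ∀ v : Site 2, meshPoint δ v ∈ D.carrier → ι v = 1 := fun v h => by simp [hι, h]
  -- the gadget and the route
  obtain ⟨gds, g, hgds, hgend, hgV, hgnd, hgx, hgx1, hgV1, hHT⟩ := gadget_data (Λ δ) hadm k ps hps
  have hgV' : ∀ v ∈ pathVerts ps gds, v = ps ∨ (meshPoint δ v ∈ D.carrier ∧ |xiC k v - xiC k ps| ≤ 1 ∧ |upC k v - upC k ps| ≤ 1) := by
    intro v hv
    rcases hgV v hv with h | h
    · exact Or.inl h
    · refine Or.inr ⟨?_, hgV1 v hv⟩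
      rw [h]
      have := mem_of_mem_zdBoundary ((Λ δ).zdArcB_subset_zdBoundary hsc.mem_zdArcB); rwa [hEΩ, hEδ] at this
  obtain ⟨Q, C, hC0, hQdata, hQsafe⟩ := route_select D c α β hcar k sp sq p q hsp0 hspq hsqL hpk hqk δ η ε hδ0 hδη hεη hεγ hδγ ι
    hι0 hι1 K₀ hK₀in hK₀out ps hpsout a hafr haseg hpa gds hgds hgV' hgnd (hgend ▸ hx0in) (hgend ▸ hgx) (hgend ▸ hgx1)
  -- the corner index and the value
  refine ⟨k + 2, -4 - ((-1 + walkTurns (k + 1) Q) + g), fun u hd hp hq _ hb ω t ht horb => ?_⟩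
  exact turnCount_touchSite D c α β hcar k sp sq p q hsp0 hsqL hpk hqk hspq.le (Λ δ) hadm δ η hδ0 hδη hδγ hEΩ hEδ hgood harcs ι hι0
    hι1 K₀ hK₀in hK₀out ps hpsout gds g hgds hgend hgV hHT Q C hC0 hQdata hQsafe u hd hp hq hb ω t ht horb

end Summit.CriticalPhenomena.CardyFormulaZ2.Cruxes.ParafermionToSLESixFamilies.PotentialDarbouxPicardDiamond

end
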